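import Summits.CriticalPhenomena.PercolationContinuityZ3.Theorems.Transplant.PlanarSkeletonFrmQuasiDefs
import Summits.CriticalPhenomena.PercolationContinuityZ3.Theorems.Transplant.SkelFrmQuasiBParamsKitSN
import Summits.CriticalPhenomena.PercolationContinuityZ3.Theorems.Transplant.SkelFrmQuasiBParamsKitS
import Summits.CriticalPhenomena.PercolationContinuityZ3.Theorems.Transplant.SkelFrmBParamsKitS
import Summits.CriticalPhenomena.PercolationContinuityZ3.Theorems.Transplant.SkelFrmQuasi1ParamsPO
import Summits.CriticalPhenomena.PercolationContinuityZ3.Theorems.Transplant.SkelFrm1ParamsPO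
import Summits.CriticalPhenomena.PercolationContinuityZ3.Theorems.Transplant.SkelFrmFromBChoiceNums
import HarnessLib

/-!
# GEN-Q HAND-HUNK DEF ROW G017 «SkelFrmFromBChoiceNums» ↦ «SkelFrmQuasiBChoiceNums» (WAVE-Q table v0.9, U-level L3; refuter p5-g28's L-FLOORMAP-1 ①⑥ 2026-08-27T09:16:46Z, design owner
# p3-g30's L-KitS-1 ruling 09:14Z = hp-8's «SkelFrmQuasiBParamsKitSN» p518036): THE (S0) KIT-CONSTANT NUMBERS `NegB.KS0` OF THE (C) RESIDUE, RE-READ WITH THE QUASI-STEP WINDOW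
# COST `N` AS A PARAMETER — `M0N`, `T0N`, `reach0N`, `base0N`, `rs0N`, `cS0N`, `sB0N`, `B0N`, **`kit0N N := ⟨N, ℓsa, M0N N, d, 0, 1, 0, A, r₀⟩**, `j₀0N`, `levels_wideN`, the counts
# `kk0N/Nk0N/Lcnt0N/j₁0N/Rlev0N/R'0N` and their ledger facts; readers take `N := KS.NQ Φ = 13·max Φ.M 1` (`kit0N_costs`)

ORIGINAL TITLE: N2 (frames-only node `SamePDropOfSkeletonFrm₁`, OPEN) — (ζ″) ledger, THE (S0) KIT-CONSTANT NUMBERS `NegB.KS0`: the kit block of the (C) residue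

builds on p205010 (kernel theorem, internal audit signed; external expert review pending) — nothing in this file uses p205010; NOTHING is claimed about any open node ((N3-b), the
end state; the quasi-step node's statement, name and wording are a lead's).  Lane `prim-bschramm`, seat `prim-bschramm-stmt` (gen 33; GEN-Q column pen, R-10e).  DEF row (review-queued
by D-0009).  Helper file (`--supports stmt-CriticalPhenomena-4575 --as helper`).
WHY A HAND HUNK AND NOT A TOKEN SWAP (p5-g28 L-FLOORMAP-1 ①⑥; same disease as L-KitS-1): «SkelFrmFromBChoiceNums» (sha256 8c9ba87f83654307…) is carrier-FREE in everything the quasi-step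
readers consume — `kit0 := ⟨13, ℓsa, M0, d, 0, 1, 0, A, r₀⟩`, `M0 := KCmax + Rs`, `reach0 := 13(T0+1) + 13d + KCmax`, `base0 := 13(T0+2) + 13d + (KCmax + Rs)`, `cS0 := 14(T0+1) + 14d + (KCmax+1) + cU`,
`levels_wide : … Dsh + 1 + d + KCmax + Rs ≤ 2j` — and these literals `13/14` and coefficient-`1` columns are exactly the UNIT-STEP kit.  The binder wave's Q clauses (captain gen-1 g4's
WAVE-Q-BINDER-rows; e.g. Q32/Q41 `kitClause_frameFC_q/…runXFC_q`, Q30/Q38 `hkits_level…CQ`, Q40 `hkits_face_of_routeFCQ`) read instead: window cost `hPN : Φ.M·(kq+3) ≤ P.N` (run frames, `kq ≤ 10`),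
`3·Φ.M ≤ P.N` (face frames), `Φ.M ≤ P.N` (root/bridge frame); tangential clamp `hT : shellD + P.N·KCmax + Rs ≤ tanOff ℓs M`; `hr₀ : P.N(T+2) + P.N·d + (P.N·KCmax + Rs) ≤ r₀`;
`hrs : 1 + (…) ≤ rs`; `hcS : (P.N+1)(T+1) + (P.N+1)d + (KCmax+1)(P.N+2) + cU ≤ cS`; `hreach : r + (P.N(T+1) + P.N·d + P.N·KCmax) ≤ r₀`; `hE : j + (…) ≤ R′`; window widths
`hDw : lo + (shellD + 1 + d + P.N·KCmax + Rs) ≤ hi`.  A token swap would type-check here and break only at the reader rows («…BParamsCorrKG», «…BChoiceRooms», «…FramesF», «…FaceLamA»,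
«…1ReachRowsQD», …).  So, exactly as hp-8's KitSN did for the apron kit `KS`, this file DECLARES THE N-PARAMETRISED VARIANTS UNDER NEW NAMES (suffix `N`, namespace
`PlanarSkeletonFrmQuasi.NegB.KS0`; `N` explicit, first after `Φ`/`κ` where present) with the original's proofs (`unfold; omega`, `N` opaque), and pins the readers' cost by
`kit0N_costs` at `N := KS.NQ Φ` (KitSN §4: `thirteen_le_NQ / one_le_NQ / M_le_NQ / M_mul_le_NQ`).  The unit-step residents `KS0.M0/T0/kit0/kit0_ok/levels_wide/…` of the FrmFrom module are
deliberately NOT exported into this namespace (a reader that still names them fails loudly instead of silently sizing a unit-step kit).  The N-free apron data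
`KS.KCmax/Rs/da/ℓsa/Dsh/cUA/…` are G011's («SkelFrmQuasiBParamsKitS» p516572).  Regression: `N = 13` gives the original's `kit0/reach0/base0/rs0` verbatim and `cS0` up to
`(KCmax+1)·15 ≥ KCmax+1` (the column cardinality of a cost-13 quasi-column; the unit-step file under-counts nothing it uses — its readers were unit-step).
FLOOR RULE (p5): every changed quantity (`T0N, reach0N, base0N, rs0N, cS0N, sB0N, B0N, j₀0N, j₁0N, Rlev0N, R'0N`) is a lower bound on a parameter chosen LATER than `Φ.M` (clamp, near/far
threshold `r₀`, shell radius, Step-III sizes, first/last level, window depth `R′`); nothing here bounds `Φ.M`.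
CONTENTS. §1 `M0N`, `T0N`, `T0N_eq`, `T0N_eq'`, `reach0N`, `base0N`, `rs0N`, `cS0N`, `sB0N`, `B0N`, `kit0N`, `kit0N_fields`, `shellD_kit0N`, `tanOff_kit0N`, **`kit0N_ok`** (the N-free clause
constants `hdD/hDρ/hKCmax` and the grown `hT`, for every `N`), **`kit0N_costs`** (at `N = KS.NQ Φ`: `Φ.M·(kq+3) ≤ N` for `kq ≤ 10`, `3·Φ.M ≤ N`, `Φ.M ≤ N`, `1 ≤ N`, `13 ≤ N`), `kit0N_sizes`
(`hrs/hcS` shapes), `hr₀_kit0N`, `hreach_kit0N`, `r₀0N`, `r₀0N_ge`, `j₀0N`, **`levels_wideN`** (`hwide/hdw/hDw` with `N·KCmax`); §2 `kk0N`, `Nk0N`, `Lcnt0N`, `j₁0N`, `Rlev0N`, `R'0N`,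
`Lcnt0N_pos`, `card_levelsN`, `hNk0N_at`, `counts_atqN`, `counts_atqN_root`, `counts_atqN_face`, `j_reach0N_le`, `R'0N_eq`, `T0N_lt_R'0N` (`1 ≤ N`).  Docstrings and citations are the original's.
[cite: KozmaNitzan2024, §4 Lemma 10 Steps II–III (pp. 18–21), Theorem 6 (pp. 25–31)] [this work]
-/

noncomputable section

open scoped Classical

namespace Summit.CriticalPhenomena.PercolationContinuityZ3.Theorems.Transplant

namespace PlanarSkeletonFrmQuasi

namespace NegB

namespace KS0

open Literature.Probability.Percolation Literature.Probability.LatticeModels SimpleGraph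
open Literature.Barriers.CriticalPhenomena (graphBall)
open SkelConc (Consts)
open BoxProdZ2 (kitK kitN kitL)
open SkelI (tanOff)
open Skelφ.StepI (DataN)
open Neg

/-! ## §1 The (S0) kit constants (no apron) at window cost `N` -/

section Consts

/-- **The tangential clamp surplus of the (S0) kit at window cost `N`** `M0,N := N·KCmax + Rs` (the quasi-column of a contact has radius `N·KCmax`; no apron summands). [this work] -/
def M0N {V : Type} (N : ℕ) (t : V) (D : Skelφ.StepI.DataNS V) (mk : ℕ) : ℕ := N * KS.KCmax t D mk + KS.Rs t D mk

/-- **The first kit level at window cost `N`** `T0,N := Dsh + M0,N = tanOff ℓsa M0,N`. [this work] -/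
def T0N {V : Type} (N : ℕ) (t : V) (D : Skelφ.StepI.DataNS V) (mk : ℕ) : ℕ := KS.Dsh t D mk + M0N N t D mk

/-- `T0,N = tanOff ℓsa M0,N`. [folklore] -/
theorem T0N_eq {V : Type} (N : ℕ) (t : V) (D : Skelφ.StepI.DataNS V) (mk : ℕ) : T0N N t D mk = tanOff (KS.ℓsa t D mk) (M0N N t D mk) := by
  unfold T0N tanOff; rw [KS.Dsh_eq]

/-- `T0,N = Dsh + N·KCmax + Rs` (the quasi-step (S0) `hT` row with equality). [folklore] -/
theorem T0N_eq' {V : Type} (N : ℕ) (t : V) (D : Skelφ.StepI.DataNS V) (mk : ℕ) : T0N N t D mk = KS.Dsh t D mk + N * KS.KCmax t D mk + KS.Rs t D mk := by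
  unfold T0N M0N; omega

/-- **The kit reach at window cost `N`** `reach0,N := N·(T0,N+1) + N·d + N·KCmax`. [this work] -/
def reach0N {V : Type} (N : ℕ) (t : V) (D : Skelφ.StepI.DataNS V) (mk : ℕ) : ℕ := N * (T0N N t D mk + 1) + N * KS.da t D mk + N * KS.KCmax t D mk

/-- **The near/far base at window cost `N`** `base0,N := N·(T0,N+2) + N·d + (N·KCmax + Rs)` (`r₀ ≥ base0,N`). [this work] -/
def base0N {V : Type} (N : ℕ) (t : V) (D : Skelφ.StepI.DataNS V) (mk : ℕ) : ℕ := N * (T0N N t D mk + 2) + N * KS.da t D mk + (N * KS.KCmax t D mk + KS.Rs t D mk)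

/-- **The seed radius at window cost `N`** `rs0,N := 1 + base0,N`. [this work] -/
def rs0N {V : Type} (N : ℕ) (t : V) (D : Skelφ.StepI.DataNS V) (mk : ℕ) : ℕ := 1 + base0N N t D mk

/-- **The Step-III region-size bound at window cost `N`** `cS0,N := (N+1)·(T0,N+1) + (N+1)·d + (KCmax + 1)·(N+2) + cU` (the quasi-column's cardinality `(KCmax+1)(N+2)`). [this work] -/
def cS0N {V : Type} {G : SimpleGraph V} [G.LocallyFinite] (Φ : PlanarSkeletonFrmQuasi G) (N : ℕ) (t : V) (D : Skelφ.StepI.DataNS V) (mk : ℕ) : ℕ :=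
  (N + 1) * (T0N N t D mk + 1) + (N + 1) * KS.da t D mk + (KS.KCmax t D mk + 1) * (N + 2) + KS.cUA Φ t D mk

/-- **The Step-III seed-size bound at window cost `N`** `sB0,N := 1 + Δ·cS0,N + cS0,N·cU` (the exponent of the (S0) `hk` row). [this work] -/
def sB0N {V : Type} {G : SimpleGraph V} [G.LocallyFinite] (Φ : PlanarSkeletonFrmQuasi G) (N : ℕ) (t : V) (D : Skelφ.StepI.DataNS V) (mk : ℕ) : ℕ :=
  1 + Φ.Δ * cS0N Φ N t D mk + cS0N Φ N t D mk * KS.cUA Φ t D mk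

/-- **The contact multiplier at window cost `N`** `B0,N := (Δ+1)^{2·rs0,N}`. [this work] -/
def B0N {V : Type} {G : SimpleGraph V} [G.LocallyFinite] (Φ : PlanarSkeletonFrmQuasi G) (N : ℕ) (t : V) (D : Skelφ.StepI.DataNS V) (mk : ℕ) : ℕ :=
  (Φ.Δ + 1) ^ (2 * rs0N N t D mk)

/-- **THE (S0) KIT RECORD AT WINDOW COST `N`** `kit0,N := ⟨N, ℓsa, M0,N, d, W := 0, ℓ := 1, R′ := 0, A, r₀⟩` (no apron: `W`, `R′` unused); `A` per frame, `r₀` a late slot. [this work] -/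
def kit0N {V : Type} (N : ℕ) (t : V) (D : Skelφ.StepI.DataNS V) (mk : ℕ) (A : ℤ) (r₀ : ℕ) : Skelφ.ApronPrm := ⟨N, KS.ℓsa t D mk, M0N N t D mk, KS.da t D mk, 0, 1, 0, A, r₀⟩

/-- The fields of `kit0,N` by name (all `rfl`). [folklore] -/
theorem kit0N_fields {V : Type} (N : ℕ) (t : V) (D : Skelφ.StepI.DataNS V) (mk : ℕ) (A : ℤ) (r₀ : ℕ) :
    (kit0N N t D mk A r₀).N = N ∧ (kit0N N t D mk A r₀).ℓs = KS.ℓsa t D mk ∧ (kit0N N t D mk A r₀).M = M0N N t D mk ∧ (kit0N N t D mk A r₀).d = KS.da t D mk ∧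
      (kit0N N t D mk A r₀).A = A ∧ (kit0N N t D mk A r₀).r₀ = r₀ := ⟨rfl, rfl, rfl, rfl, rfl, rfl⟩

/-- `shellD kit0,N = Dsh`. [folklore] -/
theorem shellD_kit0N {V : Type} (N : ℕ) (t : V) (D : Skelφ.StepI.DataNS V) (mk : ℕ) (A : ℤ) (r₀ : ℕ) : Skelφ.shellD (kit0N N t D mk A r₀) = KS.Dsh t D mk := by
  unfold Skelφ.shellD kit0N; rw [KS.Dsh_eq]

/-- `tanOff kit0,N.ℓs kit0,N.M = T0,N`. [folklore] -/
theorem tanOff_kit0N {V : Type} (N : ℕ) (t : V) (D : Skelφ.StepI.DataNS V) (mk : ℕ) (A : ℤ) (r₀ : ℕ) :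
    tanOff (kit0N N t D mk A r₀).ℓs (kit0N N t D mk A r₀).M = T0N N t D mk :=
  (T0N_eq N t D mk).symm

/-- **THE N-FREE CONSTANT INEQUALITIES OF THE QUASI-STEP (S0) CLAUSES** for `kit0,N` and shear constant `kq ≤ 10` (`|h| ≤ 10n`): `kit0,N.N = N`, `hdD` (`d + 2 ≤ shellD`), `hDρ`
(`Rs + 1 ≤ shellD`), `hKCmax` (`(shellD + M_u + 1)(kq + 1) ≤ KCmax`), and the grown clamp `hT` (`shellD + N·KCmax + Rs ≤ tanOff ℓs M`). [folklore] -/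
theorem kit0N_ok {V : Type} (N : ℕ) (t : V) (D : Skelφ.StepI.DataNS V) (mk : ℕ) (A : ℤ) (r₀ : ℕ) {kq : ℕ} (hkq : kq ≤ 10) :
    (kit0N N t D mk A r₀).N = N ∧
    (kit0N N t D mk A r₀).d + 2 ≤ Skelφ.shellD (kit0N N t D mk A r₀) ∧
    KS.Rs t D mk + 1 ≤ Skelφ.shellD (kit0N N t D mk A r₀) ∧
    (Skelφ.shellD (kit0N N t D mk A r₀) + Mu D + 1) * (kq + 1) ≤ KS.KCmax t D mk ∧
    (Skelφ.shellD (kit0N N t D mk A r₀) : ℤ) + (kit0N N t D mk A r₀).N * KS.KCmax t D mk + KS.Rs t D mk ≤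
      tanOff (kit0N N t D mk A r₀).ℓs (kit0N N t D mk A r₀).M := by
  refine ⟨rfl, ?_⟩
  rw [shellD_kit0N, tanOff_kit0N]
  simp only [kit0N]
  refine ⟨?_, KS.hDρ_at t D mk, KS.hKCmax_at t D mk (by omega), ?_⟩
  · have := KS.hD2_at t D mk; omega
  · rw [T0N_eq']; push_cast; omega

/-- **THE WINDOW COSTS OF THE READERS AT THE COST OF RECORD `N := KS.NQ Φ = 13·max Φ.M 1`** (KitSN §4): run frames `Φ.M·(kq+3) ≤ kit0,N.N` (`kq ≤ 10`), face frames
`3·Φ.M ≤ kit0,N.N`, root/bridge frame `Φ.M ≤ kit0,N.N`, and `1 ≤ kit0,N.N`, `13 ≤ kit0,N.N`. [folklore] -/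
theorem kit0N_costs {V : Type} {G : SimpleGraph V} [G.LocallyFinite] (Φ : PlanarSkeletonFrmQuasi G) (t : V) (D : Skelφ.StepI.DataNS V) (mk : ℕ) (A : ℤ) (r₀ : ℕ)
    {kq : ℕ} (hkq : kq ≤ 10) :
    Φ.M * (kq + 3) ≤ (kit0N (KS.NQ Φ) t D mk A r₀).N ∧ 3 * Φ.M ≤ (kit0N (KS.NQ Φ) t D mk A r₀).N ∧ Φ.M ≤ (kit0N (KS.NQ Φ) t D mk A r₀).N ∧
      1 ≤ (kit0N (KS.NQ Φ) t D mk A r₀).N ∧ 13 ≤ (kit0N (KS.NQ Φ) t D mk A r₀).N := by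
  simp only [kit0N]
  have h3 := KS.M_mul_le_NQ Φ (kq := 0) (by omega)
  exact ⟨KS.M_mul_le_NQ Φ hkq, by omega, KS.M_le_NQ Φ, KS.one_le_NQ Φ, KS.thirteen_le_NQ Φ⟩

/-- **The size inequalities for `kit0,N`**: `hrs` (`1 + (N(T0,N+2) + N·d + (N·KCmax+Rs)) ≤ rs0,N`) and `hcS` (`(N+1)(T0,N+1) + (N+1)d + (KCmax+1)(N+2) + cU ≤ cS0,N`). [folklore] -/
theorem kit0N_sizes {V : Type} {G : SimpleGraph V} [G.LocallyFinite] (Φ : PlanarSkeletonFrmQuasi G) (N : ℕ) (t : V) (D : Skelφ.StepI.DataNS V) (mk : ℕ) (A : ℤ) (r₀ : ℕ) :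
    1 + ((kit0N N t D mk A r₀).N * (tanOff (kit0N N t D mk A r₀).ℓs (kit0N N t D mk A r₀).M + 2) + (kit0N N t D mk A r₀).N * (kit0N N t D mk A r₀).d +
        ((kit0N N t D mk A r₀).N * KS.KCmax t D mk + KS.Rs t D mk)) ≤ rs0N N t D mk ∧
    ((kit0N N t D mk A r₀).N + 1) * (tanOff (kit0N N t D mk A r₀).ℓs (kit0N N t D mk A r₀).M + 1) + ((kit0N N t D mk A r₀).N + 1) * (kit0N N t D mk A r₀).d +
        (KS.KCmax t D mk + 1) * ((kit0N N t D mk A r₀).N + 2) + KS.cUA Φ t D mk ≤ cS0N Φ N t D mk := by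
  rw [tanOff_kit0N]
  simp only [kit0N]
  exact ⟨by unfold rs0N base0N; omega, by unfold cS0N; omega⟩

/-- **`hr₀`/`hr₀1` for `kit0,N`**: any `r₀ ≥ base0,N` satisfies `N(T0,N+2) + N·d + (N·KCmax+Rs) ≤ r₀` and `1 ≤ r₀` (for `1 ≤ N`). [folklore] -/
theorem hr₀_kit0N {V : Type} {N : ℕ} (hN : 1 ≤ N) (t : V) (D : Skelφ.StepI.DataNS V) (mk : ℕ) (A : ℤ) {r₀ : ℕ} (h : base0N N t D mk ≤ r₀) :
    (kit0N N t D mk A r₀).N * (tanOff (kit0N N t D mk A r₀).ℓs (kit0N N t D mk A r₀).M + 2) + (kit0N N t D mk A r₀).N * (kit0N N t D mk A r₀).d +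
        ((kit0N N t D mk A r₀).N * KS.KCmax t D mk + KS.Rs t D mk) ≤ (kit0N N t D mk A r₀).r₀ ∧ 1 ≤ (kit0N N t D mk A r₀).r₀ := by
  rw [tanOff_kit0N]
  simp only [kit0N]
  unfold base0N at h
  have h2 : T0N N t D mk + 2 ≤ N * (T0N N t D mk + 2) := by simpa using Nat.mul_le_mul_right (T0N N t D mk + 2) hN
  exact ⟨by omega, by omega⟩

/-- **`hreach` for `kit0,N`**: any `r₀ ≥ r + reach0,N` satisfies `r + (N(T0,N+1) + N·d + N·KCmax) ≤ r₀`. [folklore] -/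
theorem hreach_kit0N {V : Type} (N : ℕ) (t : V) (D : Skelφ.StepI.DataNS V) (mk : ℕ) (A : ℤ) {r r₀ : ℕ} (h : r + reach0N N t D mk ≤ r₀) :
    r + ((kit0N N t D mk A r₀).N * (tanOff (kit0N N t D mk A r₀).ℓs (kit0N N t D mk A r₀).M + 1) + (kit0N N t D mk A r₀).N * (kit0N N t D mk A r₀).d +
        (kit0N N t D mk A r₀).N * KS.KCmax t D mk) ≤ (kit0N N t D mk A r₀).r₀ := by
  rw [tanOff_kit0N]
  simp only [kit0N]
  unfold reach0N at h; omega

/-- **The late near/far threshold at window cost `N`** `r₀0,N Rl := max base0,N (Rl + reach0,N)` for a long-prism radius `Rl`. [this work] -/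
def r₀0N {V : Type} (N : ℕ) (t : V) (D : Skelφ.StepI.DataNS V) (mk : ℕ) (Rl : ℕ) : ℕ := max (base0N N t D mk) (Rl + reach0N N t D mk)

/-- `base0,N ≤ r₀0,N Rl` and `Rl + reach0,N ≤ r₀0,N Rl`. [folklore] -/
theorem r₀0N_ge {V : Type} (N : ℕ) (t : V) (D : Skelφ.StepI.DataNS V) (mk : ℕ) (Rl : ℕ) :
    base0N N t D mk ≤ r₀0N N t D mk Rl ∧ Rl + reach0N N t D mk ≤ r₀0N N t D mk Rl :=
  ⟨le_max_left _ _, le_max_right _ _⟩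

/-- **The first kit level at window cost `N`** `j₀0,N := T0,N`. [this work] -/
def j₀0N {V : Type} (N : ℕ) (t : V) (D : Skelφ.StepI.DataNS V) (mk : ℕ) : ℕ := T0N N t D mk

/-- **The level boxes are wide enough from `j₀0,N` on**: `j₀0,N ≤ j → 2·T0,N ≤ 2j ∧ d + 2 ≤ 2j ∧ Dsh + 1 + d + N·KCmax + Rs ≤ 2j` (the quasi-step clauses' `hwide/hdw/hDw`). [folklore] -/
theorem levels_wideN {V : Type} (N : ℕ) (t : V) (D : Skelφ.StepI.DataNS V) (mk : ℕ) {j : ℕ} (hj : j₀0N N t D mk ≤ j) :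
    2 * T0N N t D mk ≤ 2 * j ∧ KS.da t D mk + 2 ≤ 2 * j ∧ KS.Dsh t D mk + 1 + KS.da t D mk + N * KS.KCmax t D mk + KS.Rs t D mk ≤ 2 * j := by
  unfold j₀0N at hj
  have h1 := T0N_eq' N t D mk
  have h2 := KS.hD2_at t D mk
  refine ⟨by omega, by omega, by omega⟩

end Consts

/-! ## §2 The counts at the running density, at window cost `N` -/

section Counts

/-- **The number of seeds at window cost `N`** `kk0,N := kitK Δ sB0,N B0,N δkit p`. [this work] -/
def kk0N (κ : Consts) {V : Type} [DecidableEq V] [Countable V] {G : SimpleGraph V} [G.LocallyFinite] (Φ : PlanarSkeletonFrmQuasi G) (N : ℕ) (t : V) (p : unitInterval)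
    (D : Skelφ.StepI.DataNS V) (mk : ℕ) : ℕ :=
  kitK Φ.Δ (sB0N Φ N t D mk) (B0N Φ N t D mk) (Neg.δkit κ Φ) p

/-- **The number of contacts at window cost `N`** `Nk0,N := kitN Δ sB0,N B0,N δkit p`. [this work] -/
def Nk0N (κ : Consts) {V : Type} [DecidableEq V] [Countable V] {G : SimpleGraph V} [G.LocallyFinite] (Φ : PlanarSkeletonFrmQuasi G) (N : ℕ) (t : V) (p : unitInterval)
    (D : Skelφ.StepI.DataNS V) (mk : ℕ) : ℕ :=
  kitN Φ.Δ (sB0N Φ N t D mk) (B0N Φ N t D mk) (Neg.δkit κ Φ) p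

/-- **The number of levels at window cost `N`** `Lcnt0,N := kitL Δ sB0,N B0,N δkit p`. [this work] -/
def Lcnt0N (κ : Consts) {V : Type} [DecidableEq V] [Countable V] {G : SimpleGraph V} [G.LocallyFinite] (Φ : PlanarSkeletonFrmQuasi G) (N : ℕ) (t : V) (p : unitInterval)
    (D : Skelφ.StepI.DataNS V) (mk : ℕ) : ℕ :=
  kitL Φ.Δ (sB0N Φ N t D mk) (B0N Φ N t D mk) (Neg.δkit κ Φ) p

/-- **The last kit level at window cost `N`** `j₁0,N := T0,N + Lcnt0,N − 1`. [this work] -/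
def j₁0N (κ : Consts) {V : Type} [DecidableEq V] [Countable V] {G : SimpleGraph V} [G.LocallyFinite] (Φ : PlanarSkeletonFrmQuasi G) (N : ℕ) (t : V) (p : unitInterval)
    (D : Skelφ.StepI.DataNS V) (mk : ℕ) : ℕ :=
  T0N N t D mk + Lcnt0N κ Φ N t p D mk - 1

/-- **The window depth in levels at window cost `N`** `Rlev0,N := j₁0,N + reach0,N`. [this work] -/
def Rlev0N (κ : Consts) {V : Type} [DecidableEq V] [Countable V] {G : SimpleGraph V} [G.LocallyFinite] (Φ : PlanarSkeletonFrmQuasi G) (N : ℕ) (t : V) (p : unitInterval)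
    (D : Skelφ.StepI.DataNS V) (mk : ℕ) : ℕ :=
  j₁0N κ Φ N t p D mk + reach0N N t D mk

/-- **The kit-level displacement at window cost `N`** `R′0,N := Rlev0,N + 1`. [this work] -/
def R'0N (κ : Consts) {V : Type} [DecidableEq V] [Countable V] {G : SimpleGraph V} [G.LocallyFinite] (Φ : PlanarSkeletonFrmQuasi G) (N : ℕ) (t : V) (p : unitInterval)
    (D : Skelφ.StepI.DataNS V) (mk : ℕ) : ℕ :=
  Rlev0N κ Φ N t p D mk + 1

variable (κ : Consts) {V : Type} [DecidableEq V] [Countable V] {G : SimpleGraph V} [G.LocallyFinite] (Φ : PlanarSkeletonFrmQuasi G) (N : ℕ) (t : V) (p : unitInterval)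
  (D : Skelφ.StepI.DataNS V) (mk : ℕ)

/-- `0 < Lcnt0,N` (under `0 < p < 1`). [folklore] -/
theorem Lcnt0N_pos (hp0 : 0 < (p : ℝ)) (hp1 : (p : ℝ) < 1) : 0 < Lcnt0N κ Φ N t p D mk := BoxProdZ2.kitL_pos _ _ _ (Neg.δkit_pos κ Φ) p hp0 hp1

/-- **`card [j₀0,N, j₁0,N] = Lcnt0,N`** (under `0 < p < 1`). [folklore] -/
theorem card_levelsN (hp0 : 0 < (p : ℝ)) (hp1 : (p : ℝ) < 1) : (Finset.Icc (j₀0N N t D mk) (j₁0N κ Φ N t p D mk)).card = Lcnt0N κ Φ N t p D mk := by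
  have := Lcnt0N_pos κ Φ N t p D mk hp0 hp1
  rw [Nat.card_Icc]; unfold j₁0N j₀0N; omega

/-- **`kk0,N·(Δ+1)^{2·rs0,N} ≤ Nk0,N`** (the `hN` row; under `0 < p < 1`). [folklore] -/
theorem hNk0N_at (hp0 : 0 < (p : ℝ)) (hp1 : (p : ℝ) < 1) : kk0N κ Φ N t p D mk * (Φ.Δ + 1) ^ (2 * rs0N N t D mk) ≤ Nk0N κ Φ N t p D mk :=
  BoxProdZ2.kitK_mul_le_kitN _ _ _ (Neg.δkit_pos κ Φ) p hp0 hp1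

/-- **THE COUNTS AT EVERY RUNNING DENSITY `q ∈ [p/2, p]` AND EVERY ACCURACY `δ′ ≥ δkit`, AT WINDOW COST `N`** (`δ′ ∈ {κ.δ, κ.δ₂, κ.δr n}` by `Neg.δkit_le_δ/δ₂/δr`):
`(1 − q^{1+Δ·cS0,N+cS0,N·cU})^{kk0,N} ≤ δ′` (the (S0) `hk`) and `1/(1−q)^{Δ·Nk0,N} ≤ δ′·card [j₀0,N, j₁0,N]` (`hcount`). [cite: KozmaNitzan2024, §4 Lemma 10 Steps II–III (pp. 18–19)] -/
theorem counts_atqN (hp0 : 0 < (p : ℝ)) (hp1 : (p : ℝ) < 1) {q : unitInterval} (hq1 : (p : ℝ) / 2 ≤ q) (hq2 : (q : ℝ) ≤ p) {δ' : ℝ} (hδ' : Neg.δkit κ Φ ≤ δ') :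
    (1 - (q : ℝ) ^ (1 + Φ.Δ * cS0N Φ N t D mk + cS0N Φ N t D mk * KS.cUA Φ t D mk)) ^ kk0N κ Φ N t p D mk ≤ δ' ∧
      1 / (1 - (q : ℝ)) ^ (Φ.Δ * Nk0N κ Φ N t p D mk) ≤ δ' * ((Finset.Icc (j₀0N N t D mk) (j₁0N κ Φ N t p D mk)).card : ℝ) := by
  obtain ⟨hk, hc⟩ := BoxProdZ2.kit_counts_at_le Φ.Δ (sB0N Φ N t D mk) (B0N Φ N t D mk) (Neg.δkit_pos κ Φ) hδ' p hp0 hp1 hq1 hq2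
  rw [card_levelsN κ Φ N t p D mk hp0 hp1]
  exact ⟨hk, hc _ le_rfl⟩

/-- **The counts at the ROOT accuracy `κ.δr 0`, at window cost `N`** (the root leg's `hk/hcount`; `δkit ≤ δr 0`). [folklore] -/
theorem counts_atqN_root (hp0 : 0 < (p : ℝ)) (hp1 : (p : ℝ) < 1) {q : unitInterval} (hq1 : (p : ℝ) / 2 ≤ q) (hq2 : (q : ℝ) ≤ p) :
    (1 - (q : ℝ) ^ (1 + Φ.Δ * cS0N Φ N t D mk + cS0N Φ N t D mk * KS.cUA Φ t D mk)) ^ kk0N κ Φ N t p D mk ≤ κ.δr 0 ∧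
      1 / (1 - (q : ℝ)) ^ (Φ.Δ * Nk0N κ Φ N t p D mk) ≤ κ.δr 0 * ((Finset.Icc (j₀0N N t D mk) (j₁0N κ Φ N t p D mk)).card : ℝ) :=
  counts_atqN κ Φ N t p D mk hp0 hp1 hq1 hq2 (Neg.δkit_le_δr κ Φ (by norm_num))

/-- **The counts at the face accuracy `κ.δ₂`, at window cost `N`** (`δkit ≤ δ₂`). [folklore] -/
theorem counts_atqN_face (hp0 : 0 < (p : ℝ)) (hp1 : (p : ℝ) < 1) {q : unitInterval} (hq1 : (p : ℝ) / 2 ≤ q) (hq2 : (q : ℝ) ≤ p) :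
    (1 - (q : ℝ) ^ (1 + Φ.Δ * cS0N Φ N t D mk + cS0N Φ N t D mk * KS.cUA Φ t D mk)) ^ kk0N κ Φ N t p D mk ≤ κ.δ₂ ∧
      1 / (1 - (q : ℝ)) ^ (Φ.Δ * Nk0N κ Φ N t p D mk) ≤ κ.δ₂ * ((Finset.Icc (j₀0N N t D mk) (j₁0N κ Φ N t p D mk)).card : ℝ) :=
  counts_atqN κ Φ N t p D mk hp0 hp1 hq1 hq2 (Neg.δkit_le_δ₂ κ Φ)

/-- **The reach fits under `Rlev0,N`**: `j ≤ j₁0,N → j + reach0,N ≤ Rlev0,N` (the `hE` row for every frame with `R′ ≥ Rlev0,N`). [folklore] -/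
theorem j_reach0N_le {j : ℕ} (hj : j ≤ j₁0N κ Φ N t p D mk) : j + reach0N N t D mk ≤ Rlev0N κ Φ N t p D mk := by unfold Rlev0N; omega

/-- `R′0,N = j₁0,N + reach0,N + 1`, `Rlev0,N + 1 = R′0,N`, `j₁0,N ≤ Rlev0,N`. [folklore] -/
theorem R'0N_eq : R'0N κ Φ N t p D mk = j₁0N κ Φ N t p D mk + reach0N N t D mk + 1 ∧ Rlev0N κ Φ N t p D mk + 1 = R'0N κ Φ N t p D mk ∧
    j₁0N κ Φ N t p D mk ≤ Rlev0N κ Φ N t p D mk :=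
  ⟨rfl, rfl, Nat.le_add_right _ _⟩

/-- `T0,N < R′0,N`, `Rs + 2 < R′0,N`, `reach0,N < R′0,N`, `1 ≤ R′0,N` (for `1 ≤ N`). [folklore] -/
theorem T0N_lt_R'0N (hN : 1 ≤ N) :
    T0N N t D mk < R'0N κ Φ N t p D mk ∧ KS.Rs t D mk + 2 < R'0N κ Φ N t p D mk ∧ reach0N N t D mk < R'0N κ Φ N t p D mk ∧ 1 ≤ R'0N κ Φ N t p D mk := by
  have h1 : N * (T0N N t D mk + 1) ≤ reach0N N t D mk := by unfold reach0N; omega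
  have h1' : T0N N t D mk + 1 ≤ N * (T0N N t D mk + 1) := by simpa using Nat.mul_le_mul_right (T0N N t D mk + 1) hN
  have h2 := T0N_eq' N t D mk
  have h3 := KS.hDρ_at t D mk
  unfold R'0N Rlev0N; omega

end Counts

end KS0

end NegB

end PlanarSkeletonFrmQuasi

end Summit.CriticalPhenomena.PercolationContinuityZ3.Theorems.Transplant

end
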